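import Summits.ResolutionOfSingularities.ResolutionOfSingularities.Theorems.FrobeniusLadderFInjectiveMacaulayficationWildPinchCylinderAxis
import Mathlib.RingTheory.RegularLocalRing.Polynomial
import Mathlib.RingTheory.Localization.Ideal
import Mathlib.RingTheory.Localization.LocalizationLocalization
import HarnessLib

/-!
# The t-axis centre is a REGULAR closed subscheme off the origin: `Γ(D(t̄), 𝒪_{X₁}) / I_C ≅ k[t, t⁻¹]` is a regular ring
# (witness-2 datum (d4)(b) = the «concrete centre regularity» half of `goodOver_IC_off_origin`; crux `FInjectiveMacaulayfication`
# stmt-ResolutionOfSingularities-15315, chain w45a; res-L1-w45a-plan-1 R16.49, split agreed with res-L1-w45a-stub-2 22:20:59Z; seat res-L1-w45a-stub-3 g6)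

[OURS · L1 W4.5a] Support file (`--supports stmt-ResolutionOfSingularities-15315 --as helper`); NOT a statement of any manuscript; theorem-only
(no `def`, no named fact, unconditional); AI-written (AI review is weaker than expert review).

For `X₁ = Spec R`, `R = k[X₀,…,X₄]/(F)`, `t̄' ∈ Γ(X₁, ⊤)` the section of `t̄ = X̄₁`, and the t-axis ideal sheaf
`I_C = (𝔮_{0234})·𝒪_{X₁}` of `…WildPinchCylinderAxis`:
* `isRegularRing_quotient_P0234` — `R/𝔮_{0234} ≅ k[X]/(X₀,X₂,X₃,X₄) ≅ k[T]` is a regular ring;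
* `isRegularRing_localization` — a localisation of a regular ring is regular (its local rings are local rings of the ring);
* **`isRegularRing_sections_basicOpen_quotient_IC : IsRegularRing (Γ(X₁, X₁.basicOpen t̄') ⧸ I_C.ideal (X₁.basicOpen t̄'))`** — the sections
  over the basic open are the localisation `Away t̄'` of `Γ(X₁, ⊤) ≅ R` (Mathlib `isLocalization_away_of_isAffine`), the ideal is the extension
  of `𝔮_{0234}` (`ofIdealTop_ideal`), and quotient and localisation commute (Mathlib), so the ring is a localisation of the regular `R/𝔮_{0234}`.
This is the hypothesis `hC` of res-L1-w45a-stub-2's scheme-side brick (Liu 8.1.19 (a) over the regular open `D(t̄)`). [folklore; cite: Liu2002, Thm. 8.1.19 (a)]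
-/

-- single-problem summit: the doubled namespace component is forced
set_option linter.dupNamespace false

noncomputable section

open MvPolynomial IsLocalRing AlgebraicGeometry CategoryTheory Literature.AlgebraicGeometry.Resolution

namespace Summit.ResolutionOfSingularities.ResolutionOfSingularities.Theorems.FInjectiveMacaulayfication.WildPinchCylinderAxisCentre

open Summit.ResolutionOfSingularities.ResolutionOfSingularities.Theorems.FInjectiveMacaulayfication

/-! ## §1 Regular rings: localisations; `R/𝔮_{0234} ≅ k[T]` -/

-- adapted from `FiniteQuotientSingularityPresentation.isRegularRing_localization` (kept local to spare the import)
/-- **A localisation of a regular ring is regular** (its localisations at primes are localisations of the ring at primes). [folklore] -/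
theorem isRegularRing_of_isLocalization {A : Type} [CommRing A] [IsRegularRing A] (M : Submonoid A) (S : Type) [CommRing S] [Algebra A S]
    [IsLocalization M S] : IsRegularRing S := by
  haveI : IsNoetherianRing (Localization M) := IsLocalization.isNoetherianRing M (Localization M) inferInstance
  haveI : IsRegularRing (Localization M) := by
    refine isRegularRing_iff.2 fun q _ => ?_
    exact IsRegularLocalRing.of_ringEquiv (IsLocalization.localizationLocalizationAtPrimeIsoLocalization M q).toRingEquiv
  exact IsRegularRing.of_ringEquiv (Localization.algEquiv M S).toRingEquiv

variable (k : Type) [Field k] (F : MvPolynomial (Fin 5) k) (hF : F = X 2 ^ 2 + X 0 ^ 2 * X 1 * X 2 + X 0 * X 1 ^ 2)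

include hF in
/-- **`R/𝔮_{0234}` is a regular ring** (`≅ k[X]/(X₀,X₂,X₃,X₄) ≅ k[{1}]`, a polynomial ring over a field). [folklore] -/
theorem isRegularRing_quotient_P0234 :
    IsRegularRing ((MvPolynomial (Fin 5) k ⧸ Ideal.span {F}) ⧸ (Ideal.span (MvPolynomial.X '' ({0, 2, 3, 4} : Set (Fin 5)) :
      Set (MvPolynomial (Fin 5) k))).map (Ideal.Quotient.mk (Ideal.span {F}))) := by
  have hle : Ideal.span {F} ≤ Ideal.span (MvPolynomial.X '' ({0, 2, 3, 4} : Set (Fin 5)) : Set (MvPolynomial (Fin 5) k)) := by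
    rw [Ideal.span_singleton_le_iff_mem]
    exact WildPinchCylinder.F_mem_span_X k F hF (by simp) (by simp)
  let e := (DoubleQuot.quotQuotEquivQuotOfLE hle).trans
    (Literature.AlgebraicGeometry.Resolution.MvPolynomial.quotientSpanXEquiv (R := k) (τ := Fin 5) ({0, 2, 3, 4} : Set (Fin 5))).toRingEquiv
  exact IsRegularRing.of_ringEquiv e.symm

/-! ## §2 The sections of `X₁` over `D(t̄)` modulo `I_C` -/

include hF in
/-- **`Γ(X₁, D(t̄')) / I_C(D(t̄'))` is a regular ring** — the hypothesis `hC` of the scheme-side brick for (d4). With `X₁ = Spec R` affine,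
`Γ(X₁, D(t̄'))` is the localisation `Away t̄'` of `Γ(X₁, ⊤)`; `I_C(D(t̄')) = 𝔮′·Γ(X₁, D(t̄'))` for `𝔮′ =` the image of `𝔮_{0234}` in `Γ(X₁,⊤) ≅ R`;
so the quotient is a localisation of `Γ(X₁,⊤)/𝔮′ ≅ R/𝔮_{0234}`, a regular ring. [cite: Liu2002, Thm. 8.1.19 (a)] -/
theorem isRegularRing_sections_basicOpen_quotient_IC :
    IsRegularRing (Γ(Spec (.of (MvPolynomial (Fin 5) k ⧸ Ideal.span {F})),
        (Spec (.of (MvPolynomial (Fin 5) k ⧸ Ideal.span {F}))).basicOpen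
          ((Scheme.ΓSpecIso (.of (MvPolynomial (Fin 5) k ⧸ Ideal.span {F}))).inv (Ideal.Quotient.mk (Ideal.span {F}) (X 1)))) ⧸
      (Scheme.IdealSheafData.ofIdealTop (((Ideal.span (MvPolynomial.X '' ({0, 2, 3, 4} : Set (Fin 5)) :
        Set (MvPolynomial (Fin 5) k))).map (Ideal.Quotient.mk (Ideal.span {F}))).map
          (Scheme.ΓSpecIso (.of (MvPolynomial (Fin 5) k ⧸ Ideal.span {F}))).inv.hom)).ideal
        ⟨(Spec (.of (MvPolynomial (Fin 5) k ⧸ Ideal.span {F}))).basicOpen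
          ((Scheme.ΓSpecIso (.of (MvPolynomial (Fin 5) k ⧸ Ideal.span {F}))).inv (Ideal.Quotient.mk (Ideal.span {F}) (X 1))),
          (isAffineOpen_top _).basicOpen _⟩) := by
  -- names
  let R := MvPolynomial (Fin 5) k ⧸ Ideal.span {F}
  let X₁ : Scheme.{0} := Spec (.of R)
  let e₀ : Γ(X₁, ⊤) ≃+* R := (Scheme.ΓSpecIso (.of R)).commRingCatIsoToRingEquiv
  let t' : Γ(X₁, ⊤) := (Scheme.ΓSpecIso (.of R)).inv (Ideal.Quotient.mk (Ideal.span {F}) (X 1))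
  let 𝔮 : Ideal R := (Ideal.span (MvPolynomial.X '' ({0, 2, 3, 4} : Set (Fin 5)) : Set (MvPolynomial (Fin 5) k))).map
    (Ideal.Quotient.mk (Ideal.span {F}))
  let 𝔮' : Ideal Γ(X₁, ⊤) := 𝔮.map (Scheme.ΓSpecIso (.of R)).inv.hom
  -- `Γ(X₁, ⊤)/𝔮′ ≅ R/𝔮` is regular
  haveI : IsRegularRing (R ⧸ 𝔮) := isRegularRing_quotient_P0234 k F hF
  have h𝔮 : 𝔮 = 𝔮'.map (e₀ : Γ(X₁, ⊤) →+* R) := by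
    change 𝔮 = (𝔮.map (e₀.symm : R →+* Γ(X₁, ⊤))).map (e₀ : Γ(X₁, ⊤) →+* R)
    have h := Ideal.map_of_equiv (I := 𝔮) e₀.symm
    rw [RingEquiv.symm_symm] at h
    exact h.symm
  haveI : IsRegularRing (Γ(X₁, ⊤) ⧸ 𝔮') := IsRegularRing.of_ringEquiv (R := R ⧸ 𝔮) (Ideal.quotientEquiv 𝔮' 𝔮 e₀ h𝔮).symm
  -- the ideal of `I_C` over the basic open is the extension of `𝔮′`
  have hideal : (Scheme.IdealSheafData.ofIdealTop 𝔮').ideal ⟨X₁.basicOpen t', (isAffineOpen_top _).basicOpen _⟩ =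
      𝔮'.map (algebraMap Γ(X₁, ⊤) Γ(X₁, X₁.basicOpen t')) := by
    rw [Scheme.IdealSheafData.ofIdealTop_ideal]
    rfl
  -- quotient and localisation commute: the target is a localisation of `Γ(X₁, ⊤)/𝔮′`
  haveI : IsLocalization (Algebra.algebraMapSubmonoid (Γ(X₁, ⊤) ⧸ 𝔮') (Submonoid.powers t'))
      (Γ(X₁, X₁.basicOpen t') ⧸ 𝔮'.map (algebraMap Γ(X₁, ⊤) Γ(X₁, X₁.basicOpen t'))) := inferInstance
  have hreg : IsRegularRing (Γ(X₁, X₁.basicOpen t') ⧸ 𝔮'.map (algebraMap Γ(X₁, ⊤) Γ(X₁, X₁.basicOpen t'))) :=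
    isRegularRing_of_isLocalization (Algebra.algebraMapSubmonoid (Γ(X₁, ⊤) ⧸ 𝔮') (Submonoid.powers t')) _
  change IsRegularRing (Γ(X₁, X₁.basicOpen t') ⧸ (Scheme.IdealSheafData.ofIdealTop 𝔮').ideal ⟨X₁.basicOpen t', (isAffineOpen_top _).basicOpen _⟩)
  rw [hideal]
  exact hreg

include hF in
/-- The same in scheme words: **`Spec (Γ(X₁, D(t̄')) / I_C(D(t̄')))` is a regular scheme.** [cite: Liu2002, Thm. 8.1.19 (a)] -/
theorem isRegular_Spec_sections_basicOpen_quotient_IC :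
    Scheme.IsRegular (Spec (.of (Γ(Spec (.of (MvPolynomial (Fin 5) k ⧸ Ideal.span {F})),
        (Spec (.of (MvPolynomial (Fin 5) k ⧸ Ideal.span {F}))).basicOpen
          ((Scheme.ΓSpecIso (.of (MvPolynomial (Fin 5) k ⧸ Ideal.span {F}))).inv (Ideal.Quotient.mk (Ideal.span {F}) (X 1)))) ⧸
      (Scheme.IdealSheafData.ofIdealTop (((Ideal.span (MvPolynomial.X '' ({0, 2, 3, 4} : Set (Fin 5)) :
        Set (MvPolynomial (Fin 5) k))).map (Ideal.Quotient.mk (Ideal.span {F}))).map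
          (Scheme.ΓSpecIso (.of (MvPolynomial (Fin 5) k ⧸ Ideal.span {F}))).inv.hom)).ideal
        ⟨(Spec (.of (MvPolynomial (Fin 5) k ⧸ Ideal.span {F}))).basicOpen
          ((Scheme.ΓSpecIso (.of (MvPolynomial (Fin 5) k ⧸ Ideal.span {F}))).inv (Ideal.Quotient.mk (Ideal.span {F}) (X 1))),
          (isAffineOpen_top _).basicOpen _⟩))) := by
  haveI := isRegularRing_sections_basicOpen_quotient_IC k F hF
  exact Scheme.isRegular_Spec _

end Summit.ResolutionOfSingularities.ResolutionOfSingularities.Theorems.FInjectiveMacaulayfication.WildPinchCylinderAxisCentre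

end
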